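import Literature.Barriers.PneNP.Algebrization
import Literature.Computability.Complexity.AlgebrizationCollapse
import Literature.Computability.Complexity.AlgebrizationSeparation
import Literature.Computability.Complexity.OracleOneQuery
import Literature.Computability.Complexity.OracleCompositionMachine
import Literature.Computability.Complexity.CodeFPArith
import HarnessLib

/-!
# Algebrization barrier: Boolean queries to an extension oracle and the symmetric no-go theorems

Companion (barrier audit, D-0021) of `Literature/Barriers/PneNP/Algebrization.lean`.

Aaronson–Wigderson define algebrization asymmetrically (Def. 2.3: only one side receives the
extension oracle `Ã`), and the catalogue entry `Algebrization` records the two printed oracle facts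
in that asymmetric form (`NP^Ã ⊆ P^A`, Thm. 5.1; `NP^A ⊄ P^Ã`, Thm. 5.3). The full printed claim
is symmetric as well (AW p. 9): "in Section 5 we will construct oracles `A, B` and extensions
`Ã, B̃`, such that not only `P^Ã = NP^Ã` and `P^B̃ ≠ NP^B̃`, but also `NP^Ã ⊆ P^A` and
`NP^B ⊄ P^B̃`. This implies that, even under our 'broader' notion of algebrization, any resolution
of the P versus NP problem will require non-algebrizing techniques." The passage from the
asymmetric to the symmetric form is the remark of AW §1.3.2 (p. 5): an algorithm with access to
`Ã` "can always restrict itself to Boolean queries only (which are answered identically by `A` and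
`Ã`)", i.e. `P^A ⊆ P^Ã` and `NP^A ⊆ NP^Ã` whenever `Ã` extends `A`.

This file PROVES that remark in the tree's transcript model of oracle computation and derives the
symmetric no-go theorems, with no hypothesis:

* `ofLanguage_mem_FPRel_toOracle`: if `Ã` extends `A` then the language oracle of `A` is an
  `FP^Ã` function (one query `(p, n, x) = (2, |w|, w)` to `Ã`, answered `encodeNat [w ∈ A]`);
  hence `PRel_ofLanguage_subset_PRel_toOracle` (`P^A ⊆ P^Ã`) and
  `NPRel_ofLanguage_subset_NPRel_toOracle` (`NP^A ⊆ NP^Ã`) — the two monotonicity hypotheses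
  `hP`, `hNP` left open in `Algebrization.not_relativizes` / `isAlgebrizing…_of_relativizes`,
  now discharged (`Algebrization.not_relativizes'`, `isAlgebrizingInclusion_PRel_of_relativizes`,
  `isAlgebrizingSeparation_NPRel_of_relativizes`).
* `exists_symmetric_collapse`: one world `(A, Ã)`, `Ã` the multilinear extension of `A`
  (multidegree `1`), with `NP^Ã ⊆ P^A ⊆ P^Ã` (so `P^Ã = NP^Ã`, AW p. 9 first half);
  `exists_symmetric_separation`: one world with `NP^A ⊄ P^Ã` and `NP^A ⊆ NP^Ã`, so `NP^Ã ⊄ P^Ã`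
  (AW p. 9 second half).
* The symmetric no-go theorems `not_forall_symmetric_separation`
  (`¬ ∀ A Ã d, Ã ext A → NP^Ã ⊄ P^Ã`: no proof of `P ≠ NP` that relativizes with respect to
  algebraic oracles given to BOTH sides) and `not_forall_symmetric_inclusion`
  (`¬ ∀ A Ã d, Ã ext A → NP^Ã ⊆ P^Ã`); `algebrization_noGo_summary` (all four, asymmetric and
  symmetric, hypothesis-free).

## References

* S. Aaronson, A. Wigderson, *Algebrization: a new barrier in complexity theory*, STOC 2008 (full
  version), §1.3.2 p. 5, Def. 2.3 and the discussion p. 9, Thm. 5.1, Thm. 5.3 (pp. 23–24)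
  [AaronsonWigderson2008].
* R. Impagliazzo, V. Kabanets, A. Kolokolova, *An axiomatic approach to algebrization*, STOC 2009,
  §1 ("all relativizing techniques are contained in the [AW] algebrizing techniques")
  [ImpagliazzoKabanetsKolokolova2009].
* S. Arora, B. Barak, *Computational Complexity: A Modern Approach*, CUP 2009, §3.4 (oracle
  machines) [AroraBarak2009].
-/

namespace Literature.Barriers.PneNP

open _root_.Computability Literature.Computability.Complexity Brick CodeFP Polynomial

/-! ### The Boolean query to an extension oracle -/

/-- The numeral of a bit, `b ↦ [b]` as `0/1`, is computed on codes. [cite: AroraBarak2009, §1.3] -/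
theorem codeFP_bitNat : CodeFP bitE natE (fun b : Bool => if b then (1 : ℕ) else 0) :=
  CodeFP.ite (p := fun b : Bool => b) (CodeFP.id bitE) (const bitE (1 : ℕ)) (const bitE (0 : ℕ))

/-- **The Boolean query is polynomial time**: the map sending a string `w` to the extension-oracle
query `(p, n, x) = (2, |w|, w)` (`encodingExtQuery`, the point `w ∈ {0,1}^{|w|} ⊆ 𝔽₂^{|w|}`) is an
`FP` function (assembled from the typed `CodeFP` combinators: bits of `w`, `map`, length, pairing).
[cite: AaronsonWigderson2008, §1.3.2 p. 5] [cite: AroraBarak2009, §1.3] -/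
theorem exists_boolQuery_mem_FP :
    ∃ Q ∈ FP, ∀ w : List Bool,
      Q w = encodingExtQuery.encode ⟨2, w.length, fun i => if w.get i then (1 : ℕ) else 0⟩ := by
  -- a string as the raw list of its bits (chunks of length one), as in
  -- `Literature.Computability.Complexity.IoHard.codeFP_strToRaw` (not imported: heavy module)
  have hbits : CodeFP strE (rawE bitE) (fun l : List Bool => l) := by
    have h := strChunks.comp (strLength.pair ((const strE (1 : ℕ)).pair (CodeFP.id strE)))
    refine h.recodeOut fun l => ?_
    show rawE strE ((List.range l.length).map fun i => (l.drop (i * 1)).take 1) = rawE bitE l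
    unfold rawE
    congr 1
    rw [List.map_map]
    apply List.ext_getElem
    · simp
    · intro i h₁ h₂
      rw [List.length_map, List.length_range] at h₁
      simp [bitE, strE, List.take_one_drop_eq_of_lt_length h₁]
  have hl : CodeFP strE (listE natE) (fun w : List Bool => w.map fun b => if b then (1 : ℕ) else 0) :=
    (listOfRaw natE).comp ((map₀ codeFP_bitNat).comp hbits)
  have h : CodeFP strE (pairE natE (pairE natE (listE natE)))
      (fun w : List Bool => ((2 : ℕ), (w.length, w.map fun b => if b then (1 : ℕ) else 0))) :=
    (const strE (2 : ℕ)).pair (strNatLength.pair hl)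
  obtain ⟨Q, hQ, hQe⟩ := h
  refine ⟨Q, hQ, fun w => (hQe w).trans ?_⟩
  have hof : (List.ofFn fun i => if w.get i then (1 : ℕ) else 0) =
      w.map fun b => if b then (1 : ℕ) else 0 := by
    apply List.ext_getElem <;> simp
  have he : (encodingListNatBool.encode : List ℕ → List Bool) = listE natE := by
    rw [show (encodingListNatBool : Encoding (List ℕ) Bool) = encodingNatBool.listBool from rfl,
      listE_eq, natE_eq]
  change boolPair (natE 2) (boolPair (natE w.length) (listE natE _)) =
    boolPair (encodeNat 2) (boolPair (encodeNat w.length)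
      (encodingListNatBool.encode (List.ofFn fun i => if w.get i then (1 : ℕ) else 0)))
  rw [hof, he]

/-- **Boolean queries are answered identically by `A` and `Ã`** (AW §1.3.2): for an extension `Ã`
of `A` (any multidegree bound `d`), the query `(2, |w|, w)` is answered by the code of the residue
`Ã_{|w|,𝔽₂}(w) = [w ∈ A] ∈ 𝔽₂`, i.e. by `encodeNat 1 = [true]` if `w ∈ A` and `encodeNat 0 = []`
otherwise. [cite: AaronsonWigderson2008, §1.3.2 p. 5 and Def. 2.2] -/
theorem toOracle_boolQuery {Ã : ExtensionOracle} {A : Language Bool} {d : ℕ}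
    (h : Ã.IsExtensionOf A d) (w : List Bool) :
    Ã.toOracle (encodingExtQuery.encode ⟨2, w.length, fun i => if w.get i then (1 : ℕ) else 0⟩) =
      if A.boolIndicator w then [true] else [] := by
  have hspec : Ã.toOracle
      (encodingExtQuery.encode ⟨2, w.length, fun i => if w.get i then (1 : ℕ) else 0⟩) =
      encodeNat (ZMod.val (MvPolynomial.eval
        (fun i => (((if w.get i then (1 : ℕ) else 0 : ℕ)) : ZMod 2))
        (Ã.poly ⟨2, Nat.prime_two⟩ w.length))) :=
    Ã.toOracle_spec ⟨2, Nat.prime_two⟩ w.length fun i => if w.get i then (1 : ℕ) else 0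
  have hpt : (fun i => (((if w.get i then (1 : ℕ) else 0 : ℕ)) : ZMod 2)) =
      fun i => if w.get i then (1 : ZMod 2) else 0 := by
    funext i
    cases w.get i <;> simp
  have hext := (h ⟨2, Nat.prime_two⟩ w.length).2 w.get
  have hslice : A.sliceFn w.length w.get = A.boolIndicator w := by
    simp [Language.sliceFn, List.ofFn_get]
  have e1 : encodeNat (ZMod.val (1 : ZMod 2)) = [true] := by decide
  have e0 : encodeNat (ZMod.val (0 : ZMod 2)) = [] := by decide
  rw [hspec, hpt, hext, hslice]
  cases A.boolIndicator w
  exacts [e0, e1]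

/-! ### `P^A ⊆ P^Ã` and `NP^A ⊆ NP^Ã` -/

/-- **The language oracle of `A` is an `FP^Ã` function** for every extension `Ã` of `A`
(AW §1.3.2 p. 5: an algorithm querying `Ã` "can always restrict itself to Boolean queries only
(which are answered identically by `A` and `Ã`)"): the one-query algorithm asking `(2, |w|, w)` and
outputting the bit `[answer = [true]]`. [cite: AaronsonWigderson2008, §1.3.2 p. 5] -/
theorem ofLanguage_mem_FPRel_toOracle {Ã : ExtensionOracle} {A : Language Bool} {d : ℕ}
    (h : Ã.IsExtensionOf A d) : Oracle.ofLanguage A ∈ FPRel Ã.toOracle := by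
  classical
  obtain ⟨Q, hQ, hQe⟩ := exists_boolQuery_mem_FP
  obtain ⟨s, hs⟩ := exists_poly_length_le_of_mem_FP hQ
  -- the output stage: the bit `[a = [true]]` read off the transcript code `⟨x, a⟩`
  have hout : CodeFP strE bitE (fun z : List Bool => decide (sndF z = [true])) :=
    (CodeFP.eq (eα := strE) fun _ _ hab => hab).comp
      ((CodeFP.of_fn (eα := strE) (eβ := strE) sndF sndF_mem_FP fun _ => rfl).pair
        (const strE [true]))
  obtain ⟨Out, hOut, hOute⟩ := hout
  refine ⟨OracleAlg.oneQuery (fun _ => [true]) Q (fun _ => []) Out,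
    OracleAlg.isPolyTime_oneQuery _ _ _ _ (const_mem_FP _) (oneBit_const true) hQ
      (const_mem_FP _) hOut, s + 2, fun x => ?_⟩
  have hev : (s + 2 : Polynomial ℕ).eval x.length = s.eval x.length + 2 := by simp
  refine ⟨?_, fun y hy => ?_⟩
  · rw [hev, OracleAlg.run_oneQuery_pos (fun _ => [true]) Q (fun _ => []) Out Ã.toOracle rfl]
    congr 1
    have h1 : Out (boolPair x (Ã.toOracle (Q x))) = [decide (Ã.toOracle (Q x) = [true])] := by
      have := hOute (boolPair x (Ã.toOracle (Q x)))
      simpa [strE, bitE] using this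
    rw [h1, hQe x, toOracle_boolQuery h x]
    unfold Oracle.ofLanguage
    cases A.boolIndicator x <;> simp [encodeBool]
  · rw [hev, OracleAlg.queries_oneQuery_pos (fun _ => [true]) Q (fun _ => []) Out Ã.toOracle rfl]
      at hy
    rw [List.mem_singleton] at hy
    subst hy
    exact (hs x).trans (by rw [hev]; exact Nat.le_add_right _ _)

/-- **`P^A ⊆ P^Ã`** whenever `Ã` extends `A` (Boolean queries; polynomial-time oracle machines
compose, `OracleAlg.PRel_subset_PRel_of_mem_FPRel`). This discharges the hypothesis `hP` of
`Algebrization.not_relativizes`. [cite: AaronsonWigderson2008, §1.3.2 p. 5] -/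
theorem PRel_ofLanguage_subset_PRel_toOracle {Ã : ExtensionOracle} {A : Language Bool} {d : ℕ}
    (h : Ã.IsExtensionOf A d) : PRel (Oracle.ofLanguage A) ⊆ PRel Ã.toOracle :=
  OracleAlg.PRel_subset_PRel_of_mem_FPRel (ofLanguage_mem_FPRel_toOracle h)

/-- **`NP^A ⊆ NP^Ã`** whenever `Ã` extends `A` (`NP^O = ∃ᵖ·P^O` is monotone in `P^O`). This
discharges the hypothesis `hNP` of `Algebrization.not_relativizes`.
[cite: AaronsonWigderson2008, §1.3.2 p. 5] -/
theorem NPRel_ofLanguage_subset_NPRel_toOracle {Ã : ExtensionOracle} {A : Language Bool} {d : ℕ}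
    (h : Ã.IsExtensionOf A d) : NPRel (Oracle.ofLanguage A) ⊆ NPRel Ã.toOracle := by
  rw [NPRel_eq, NPRel_eq]
  exact polyExists_mono (PRel_ofLanguage_subset_PRel_toOracle h)

/-! ### Relativizing implies algebrizing, hypothesis-free -/

/-- An inclusion `C ⊆ P` (right-hand class `P^·`) that relativizes over language oracles
algebrizes — `isAlgebrizingInclusion_of_relativizes` with its monotonicity hypothesis discharged.
[cite: ImpagliazzoKabanetsKolokolova2009, §1 p. 3] [cite: AaronsonWigderson2008, §1.3.2 p. 5] -/
theorem isAlgebrizingInclusion_PRel_of_relativizes {C : Oracle → Set (Language Bool)}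
    (h : Relativizes fun O => C O ⊆ PRel O) : IsAlgebrizingInclusion C PRel :=
  isAlgebrizingInclusion_of_relativizes (fun _ _ _ hÃ => PRel_ofLanguage_subset_PRel_toOracle hÃ) h

/-- A separation `NP ⊄ D` (left-hand class `NP^·`) that relativizes over language oracles
algebrizes — `isAlgebrizingSeparation_of_relativizes` with its monotonicity hypothesis
discharged. [cite: ImpagliazzoKabanetsKolokolova2009, §1 p. 3] [cite: AaronsonWigderson2008, Def. 2.3] -/
theorem isAlgebrizingSeparation_NPRel_of_relativizes {D : Oracle → Set (Language Bool)}
    (h : Relativizes fun O => ¬ NPRel O ⊆ D O) : IsAlgebrizingSeparation NPRel D :=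
  isAlgebrizingSeparation_of_relativizes
    (fun _ _ _ hÃ => NPRel_ofLanguage_subset_NPRel_toOracle hÃ) h

/-- **The algebrization barrier contains the relativization barrier for `P` vs `NP`**, with no
hypothesis (`Algebrization.not_relativizes` fed with the monotonicity theorems and with the tree's
proofs of AW Thm. 5.1 / 5.3): neither `O ↦ NP^O ⊆ P^O` nor `O ↦ NP^O ⊄ P^O` relativizes.
[cite: AaronsonWigderson2008, §5.1] [cite: ImpagliazzoKabanetsKolokolova2009, §1 p. 3] -/
theorem Algebrization.not_relativizes' :
    (¬ Relativizes fun O => NPRel O ⊆ PRel O) ∧ ¬ Relativizes fun O => ¬ NPRel O ⊆ PRel O :=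
  (Algebrization.of_aw aaronson_wigderson_collapse_holds
      aaronson_wigderson_separation_holds).not_relativizes
    (fun _ _ _ hÃ => PRel_ofLanguage_subset_PRel_toOracle hÃ)
    (fun _ _ _ hÃ => NPRel_ofLanguage_subset_NPRel_toOracle hÃ)

/-! ### The symmetric forms (AW p. 9) -/

/-- **The collapsing world, symmetric form** (AW Thm. 5.1 with p. 9: "not only `P^Ã = NP^Ã` …
but also `NP^Ã ⊆ P^A`"): for the multilinear extension `Ã` (multidegree `≤ 1`) of the tree's
collapsing oracle `A` (`exists_multilinearExtension_NPRel_subset_PRel`, `AlgebrizationCollapse.lean`),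
`NP^Ã ⊆ P^A ⊆ P^Ã`; in particular `NP^Ã ⊆ P^Ã`, i.e. `P^Ã = NP^Ã`.
[cite: AaronsonWigderson2008, Thm. 5.1 and p. 9] -/
theorem exists_symmetric_collapse :
    ∃ (A : Language Bool) (Ã : ExtensionOracle), Ã.IsExtensionOf A 1 ∧
      NPRel Ã.toOracle ⊆ PRel (Oracle.ofLanguage A) ∧
      PRel (Oracle.ofLanguage A) ⊆ PRel Ã.toOracle ∧
      NPRel Ã.toOracle ⊆ PRel Ã.toOracle := by
  obtain ⟨A, hÃ, hsub⟩ := exists_multilinearExtension_NPRel_subset_PRel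
  exact ⟨A, multilinearExtension A, hÃ, hsub, PRel_ofLanguage_subset_PRel_toOracle hÃ,
    hsub.trans (PRel_ofLanguage_subset_PRel_toOracle hÃ)⟩

/-- **The separating world, symmetric form** (AW Thm. 5.3 with p. 9: "`P^B̃ ≠ NP^B̃` … and
`NP^B ⊄ P^B̃`"): there are `A` and an extension `Ã` of `A` (some multidegree bound; `2` in the
tree's proof `aaronson_wigderson_separation_holds`) with `NP^A ⊄ P^Ã` and `NP^A ⊆ NP^Ã`, hence
`NP^Ã ⊄ P^Ã`. [cite: AaronsonWigderson2008, Thm. 5.3 and p. 9] -/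
theorem exists_symmetric_separation :
    ∃ (A : Language Bool) (Ã : ExtensionOracle) (d : ℕ), Ã.IsExtensionOf A d ∧
      ¬ NPRel (Oracle.ofLanguage A) ⊆ PRel Ã.toOracle ∧
      NPRel (Oracle.ofLanguage A) ⊆ NPRel Ã.toOracle ∧
      ¬ NPRel Ã.toOracle ⊆ PRel Ã.toOracle := by
  obtain ⟨A, Ã, d, hÃ, hnot⟩ := aaronson_wigderson_separation_holds
  exact ⟨A, Ã, d, hÃ, hnot, NPRel_ofLanguage_subset_NPRel_toOracle hÃ,
    fun hsub => hnot ((NPRel_ofLanguage_subset_NPRel_toOracle hÃ).trans hsub)⟩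

/-- **No proof of `P ≠ NP` relativizes with respect to algebraic oracles given to both sides**
(the symmetric, Fortnow / IKK-style reading; AW p. 9 "even under our 'broader' notion"): it is
not the case that `NP^Ã ⊄ P^Ã` for every oracle `A` and every low-degree extension `Ã` of `A`.
[cite: AaronsonWigderson2008, p. 9 and Thm. 5.1] -/
theorem not_forall_symmetric_separation :
    ¬ ∀ (A : Language Bool) (Ã : ExtensionOracle) (d : ℕ), Ã.IsExtensionOf A d →
      ¬ NPRel Ã.toOracle ⊆ PRel Ã.toOracle := by
  obtain ⟨A, Ã, hÃ, -, -, hsub⟩ := exists_symmetric_collapse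
  exact fun hall => hall A Ã 1 hÃ hsub

/-- **No proof of `P = NP` relativizes with respect to algebraic oracles given to both sides**:
it is not the case that `NP^Ã ⊆ P^Ã` for every `A` and every low-degree extension `Ã` of `A`.
[cite: AaronsonWigderson2008, p. 9 and Thm. 5.3] -/
theorem not_forall_symmetric_inclusion :
    ¬ ∀ (A : Language Bool) (Ã : ExtensionOracle) (d : ℕ), Ã.IsExtensionOf A d →
      NPRel Ã.toOracle ⊆ PRel Ã.toOracle := by
  obtain ⟨A, Ã, d, hÃ, -, -, hnot⟩ := exists_symmetric_separation
  exact fun hall => hnot (hall A Ã d hÃ)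

/-- Summary of the four no-go statements for `P` vs `NP` — asymmetric (AW Def. 2.3:
`IsAlgebrizingSeparation` / `IsAlgebrizingInclusion`) and symmetric — all hypothesis-free.
[cite: AaronsonWigderson2008, §5.1 and p. 9] -/
theorem algebrization_noGo_summary :
    ¬ IsAlgebrizingSeparation NPRel PRel ∧ ¬ IsAlgebrizingInclusion NPRel PRel ∧
      (¬ ∀ (A : Language Bool) (Ã : ExtensionOracle) (d : ℕ), Ã.IsExtensionOf A d →
          ¬ NPRel Ã.toOracle ⊆ PRel Ã.toOracle) ∧
        ¬ ∀ (A : Language Bool) (Ã : ExtensionOracle) (d : ℕ), Ã.IsExtensionOf A d →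
          NPRel Ã.toOracle ⊆ PRel Ã.toOracle :=
  have h := Algebrization.of_aw aaronson_wigderson_collapse_holds aaronson_wigderson_separation_holds
  ⟨h.not_isAlgebrizingSeparation_NP_P, h.not_isAlgebrizingInclusion_NP_P,
    not_forall_symmetric_separation, not_forall_symmetric_inclusion⟩

/-- **`AlgebrizationNarrow` holds (DISCHARGE of the named fact of `Algebrization.lean`)** — the
narrowed, symmetric form of the algebrization barrier for `P` versus `NP`: the multilinear
collapsing world of Thm. 5.1 (`NP^Ã ⊆ P^A ⊆ P^Ã`, from `exists_symmetric_collapse`) and the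
separating world of Thm. 5.3 with the monotonicity `NP^A ⊆ NP^Ã` (from
`exists_symmetric_separation`). This is the theorem the docstrings of `AlgebrizationNarrow` and of
`BarrierCatalogue.lean` (A7) name; it assembles the two symmetric forms above and nothing else.
[cite: AaronsonWigderson2008, Thm. 5.1, Thm. 5.3 and p. 9] -/
theorem algebrizationNarrow_holds : AlgebrizationNarrow := by
  obtain ⟨A, Ã, hÃ, h1, h2, -⟩ := exists_symmetric_collapse
  obtain ⟨B, B', d, hB, h3, h4, -⟩ := exists_symmetric_separation
  exact ⟨⟨A, Ã, hÃ, h1, h2⟩, B, B', d, hB, h3, h4⟩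

end Literature.Barriers.PneNP
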